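import Summits.QuantumFields.YangMills.Theorems.ColdStartUniversalityColdStartSolutionsExistFlatFiltration
import Summits.QuantumFields.YangMills.Theorems.ColdStartUniversalityColdStartSolutionsExistProgressive
import HarnessLib

/-!
# Route `ColdStartUniversality`, support item S (stmt-QuantumFields-24811), line `piwiener`:
# the stochastic integrals of one Picard step exist (tame coefficients along an `L²(sup)` progressive process)

Helper file (lead `ym-line-csu-p1`) — the first step of stub A `stub_ambientStrongExistence` (vector Picard
iteration; the analogue of `PicardInv.lintegral_along_sq_lt_top` / `PicardInv.exists_isItoIntegral` of the tree's
1-D `Literature/Analysis/FunctionSpaces/ItoProcessesProofs.lean`).  Setting: any probability space with a flat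
Brownian motion `W` (filtration `𝓕 = hW.natFiltration`), a link SDE `S` on `M₂(ℂ)^E` whose coefficients obey the
tame squared-Frobenius Lipschitz bound with constant `K`, and a matrix-configuration process `Y` which is
entrywise progressive and in `L²(sup)` on bounded intervals (`E[sup_{s≤t} Σ_e ‖Y_s e‖_F²] < ∞`).

* `hsForm_le_two_mul_add` — `‖a‖² ≤ 2‖a − b‖² + 2‖b‖²` for the Hilbert–Schmidt form;
* `hsForm_coeff_linearGrowth` — linear growth `‖σ(Q) e n‖_F² ≤ 2‖σ(0) e n‖_F² + 2K Σ_e' ‖Q e'‖_F²` (and the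
  same for the drift) from the Lipschitz bound at `Q' = 0`;
* `sq_re_le_hsForm`, `sq_im_le_hsForm` — an entry is dominated by the Frobenius norm;
* `sqErr_noise_ne_top` — `E ∫₀ᵗ (Re/Im σ(Y_s)_{e,n,ij})² ds < ∞`;
* `exists_isItoIntegral_noise_re/_im` — hence the Itô integrals `∫ Re/Im σ(Y)_{e,n,ij} dW^{(e,n)}` of the
  Picard step exist w.r.t. `𝓕` and are square-integrable martingales (`exists_isItoIntegral_flatCoord`,
  progressivity from `…Progressive`).

No definition, no sorry, standard axioms.  RECORD-rung plumbing; nothing here bears on the mass gap.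
-/

set_option autoImplicit false

noncomputable section

namespace Summit.QuantumFields.YangMills.Theorems.ColdStartUniversality

open MeasureTheory ProbabilityTheory Filter Topology Matrix Finset
open scoped NNReal ENNReal BigOperators
open Literature.Probability.Process Literature.MathematicalPhysics.QuantumFieldTheory

/-! ### Hilbert–Schmidt inequalities -/

section HS

variable {N : ℕ}

/-- `2⟨u, v⟩ ≤ ⟨u, u⟩ + ⟨v, v⟩`. [folklore] -/
theorem two_mul_hsForm_le (u v : Matrix (Fin N) (Fin N) ℂ) :
    2 * hsForm N u v ≤ hsForm N u u + hsForm N v v := by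
  have h := hsForm_self_nonneg (u - v)
  simp only [map_sub, LinearMap.sub_apply] at h
  linarith [hsForm_comm u v]

/-- `‖a‖² ≤ 2‖a − b‖² + 2‖b‖²` for the Hilbert–Schmidt form. [folklore] -/
theorem hsForm_le_two_mul_add (a b : Matrix (Fin N) (Fin N) ℂ) :
    hsForm N a a ≤ 2 * hsForm N (a - b) (a - b) + 2 * hsForm N b b := by
  have h := two_mul_hsForm_le (a - b) b
  have hab : a = (a - b) + b := by abel
  have hexp : hsForm N a a = hsForm N (a - b) (a - b) + 2 * hsForm N (a - b) b + hsForm N b b := by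
    conv_lhs => rw [hab]
    simp only [map_add, LinearMap.add_apply]
    linarith [hsForm_comm (a - b) b]
  linarith [hsForm_self_nonneg (a - b), hsForm_self_nonneg b]

/-- `(Re M i j)² ≤ ‖M‖_F²`. [folklore] -/
theorem sq_re_le_hsForm (M : Matrix (Fin N) (Fin N) ℂ) (i j : Fin N) : (M i j).re ^ 2 ≤ hsForm N M M := by
  rw [hsForm_self]
  calc (M i j).re ^ 2 ≤ ‖M i j‖ ^ 2 := by
        rw [← sq_abs]
        exact pow_le_pow_left₀ (abs_nonneg _) (Complex.abs_re_le_norm _) 2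
    _ ≤ ∑ j', ‖M i j'‖ ^ 2 := Finset.single_le_sum (f := fun j' => ‖M i j'‖ ^ 2) (fun _ _ => by positivity)
        (Finset.mem_univ j)
    _ ≤ ∑ i', ∑ j', ‖M i' j'‖ ^ 2 := Finset.single_le_sum (f := fun i' => ∑ j', ‖M i' j'‖ ^ 2)
        (fun _ _ => Finset.sum_nonneg fun _ _ => by positivity) (Finset.mem_univ i)

/-- `(Im M i j)² ≤ ‖M‖_F²`. [folklore] -/
theorem sq_im_le_hsForm (M : Matrix (Fin N) (Fin N) ℂ) (i j : Fin N) : (M i j).im ^ 2 ≤ hsForm N M M := by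
  rw [hsForm_self]
  calc (M i j).im ^ 2 ≤ ‖M i j‖ ^ 2 := by
        rw [← sq_abs]
        exact pow_le_pow_left₀ (abs_nonneg _) (Complex.abs_im_le_norm _) 2
    _ ≤ ∑ j', ‖M i j'‖ ^ 2 := Finset.single_le_sum (f := fun j' => ‖M i j'‖ ^ 2) (fun _ _ => by positivity)
        (Finset.mem_univ j)
    _ ≤ ∑ i', ∑ j', ‖M i' j'‖ ^ 2 := Finset.single_le_sum (f := fun i' => ∑ j', ‖M i' j'‖ ^ 2)
        (fun _ _ => Finset.sum_nonneg fun _ _ => by positivity) (Finset.mem_univ i)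

end HS

/-! ### Linear growth of tame coefficients -/

section Growth

variable {L : ℕ} [NeZero L]

/-- **Linear growth from the tame Lipschitz bound**: if `‖f Q − f Q'‖_F² ≤ K Σ_e' ‖Q e' − Q' e'‖_F²` then
`‖f Q‖_F² ≤ 2‖f 0‖_F² + 2K Σ_e' ‖Q e'‖_F²`. [folklore] -/
theorem hsForm_coeff_linearGrowth {f : MatrixConfig 3 L 2 → Matrix (Fin 2) (Fin 2) ℂ} {K : ℝ}
    (hf : ∀ Q Q' : MatrixConfig 3 L 2,
      hsForm 2 (f Q - f Q') (f Q - f Q') ≤ K * ∑ e', hsForm 2 (Q e' - Q' e') (Q e' - Q' e'))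
    (Q : MatrixConfig 3 L 2) :
    hsForm 2 (f Q) (f Q) ≤ 2 * hsForm 2 (f 0) (f 0) + 2 * K * ∑ e', hsForm 2 (Q e') (Q e') := by
  have h := hf Q 0
  simp only [Pi.zero_apply, sub_zero] at h
  have h2 := hsForm_le_two_mul_add (f Q) (f 0)
  nlinarith

end Growth

/-! ### Square integrability of the Picard integrands and their Itô integrals -/

section Integrals

variable {Ω : Type*} {mΩ : MeasurableSpace Ω} {P : Measure Ω} {L : ℕ} [NeZero L]
  {W : ℝ≥0 → Ω → (Edge 3 L × NoiseIdx 2 → ℝ)}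

/-- **`E ∫₀ᵗ g(Y_s)² ds < ∞` for an entry-dominated functional of an `L²(sup)` process.**  If
`g(Q)² ≤ C₀ + C₁ Σ_e ‖Q e‖_F²` pointwise (`C₀, C₁ ≥ 0`) and `E[sup_{s≤t} Σ_e ‖Y_s e‖_F²] < ∞`, then
`sqErr (g ∘ Y) 0 P t ≠ ∞`. [folklore] -/
theorem sqErr_ne_top_of_dominated [IsProbabilityMeasure P] {Y : ℝ≥0 → Ω → MatrixConfig 3 L 2}
    {g : MatrixConfig 3 L 2 → ℝ} {C₀ C₁ : ℝ} (hC₀ : 0 ≤ C₀) (hC₁ : 0 ≤ C₁)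
    (hg : ∀ Q, g Q ^ 2 ≤ C₀ + C₁ * ∑ e, hsForm 2 (Q e) (Q e))
    (hY2 : ∀ t : ℝ≥0, ∫⁻ ω, ⨆ s ∈ Set.Iic t, ENNReal.ofReal (∑ e, hsForm 2 (Y s ω e) (Y s ω e)) ∂P < ∞)
    (t : ℝ≥0) : sqErr (fun s ω => g (Y s ω)) 0 P t ≠ ⊤ := by
  rw [sqErr]
  simp only [Pi.zero_apply, sub_zero]
  have hpt : ∀ ω, ∫⁻ s in Set.Icc (0 : ℝ) t, ENNReal.ofReal (g (Y s.toNNReal ω) ^ 2) ≤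
      (ENNReal.ofReal C₀ + ENNReal.ofReal C₁ *
        ⨆ s ∈ Set.Iic t, ENNReal.ofReal (∑ e, hsForm 2 (Y s ω e) (Y s ω e))) * volume (Set.Icc (0 : ℝ) t) := by
    intro ω
    rw [← setLIntegral_const]
    refine setLIntegral_mono' measurableSet_Icc fun s hs => ?_
    have hst : s.toNNReal ∈ Set.Iic t := Real.toNNReal_le_iff_le_coe.2 hs.2
    calc ENNReal.ofReal (g (Y s.toNNReal ω) ^ 2)
        ≤ ENNReal.ofReal (C₀ + C₁ * ∑ e, hsForm 2 (Y s.toNNReal ω e) (Y s.toNNReal ω e)) :=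
          ENNReal.ofReal_le_ofReal (hg _)
      _ = ENNReal.ofReal C₀ + ENNReal.ofReal C₁ *
            ENNReal.ofReal (∑ e, hsForm 2 (Y s.toNNReal ω e) (Y s.toNNReal ω e)) := by
          rw [ENNReal.ofReal_add hC₀ (mul_nonneg hC₁ (Finset.sum_nonneg fun _ _ => hsForm_self_nonneg _)),
            ENNReal.ofReal_mul hC₁]
      _ ≤ _ := by
          gcongr
          exact le_iSup₂_of_le s.toNNReal hst le_rfl
  refine ne_of_lt ?_
  calc ∫⁻ ω, (∫⁻ s in Set.Icc (0 : ℝ) t, ENNReal.ofReal (g (Y s.toNNReal ω) ^ 2)) ∂P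
      ≤ ∫⁻ ω, (ENNReal.ofReal C₀ + ENNReal.ofReal C₁ *
          ⨆ s ∈ Set.Iic t, ENNReal.ofReal (∑ e, hsForm 2 (Y s ω e) (Y s ω e))) * volume (Set.Icc (0 : ℝ) t) ∂P :=
        lintegral_mono hpt
    _ = (ENNReal.ofReal C₀ * P Set.univ + ENNReal.ofReal C₁ *
          ∫⁻ ω, ⨆ s ∈ Set.Iic t, ENNReal.ofReal (∑ e, hsForm 2 (Y s ω e) (Y s ω e)) ∂P) *
            volume (Set.Icc (0 : ℝ) t) := by
        rw [lintegral_mul_const' _ _ measure_Icc_lt_top.ne, lintegral_add_left measurable_const,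
          lintegral_const, lintegral_const_mul' _ _ ENNReal.ofReal_ne_top]
    _ < ⊤ := by
        refine ENNReal.mul_lt_top (ENNReal.add_lt_top.2 ⟨?_, ?_⟩) measure_Icc_lt_top
        · exact ENNReal.mul_lt_top ENNReal.ofReal_lt_top (measure_lt_top _ _)
        · exact ENNReal.mul_lt_top ENNReal.ofReal_lt_top (hY2 t)

/-- **The Itô integrands of a Picard step are square integrable**: for a tame coefficient map `f`
(`‖f Q − f Q'‖_F² ≤ K Σ ‖Q e' − Q' e'‖_F²`) along an `L²(sup)` process `Y`, the real and imaginary parts of every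
entry `f(Y_s)_{ij}` have `E ∫₀ᵗ (·)² ds < ∞`. [folklore] -/
theorem sqErr_coeff_entry_ne_top [IsProbabilityMeasure P] {Y : ℝ≥0 → Ω → MatrixConfig 3 L 2}
    {f : MatrixConfig 3 L 2 → Matrix (Fin 2) (Fin 2) ℂ} {K : ℝ}
    (hf : ∀ Q Q' : MatrixConfig 3 L 2,
      hsForm 2 (f Q - f Q') (f Q - f Q') ≤ K * ∑ e', hsForm 2 (Q e' - Q' e') (Q e' - Q' e'))
    (hY2 : ∀ t : ℝ≥0, ∫⁻ ω, ⨆ s ∈ Set.Iic t, ENNReal.ofReal (∑ e, hsForm 2 (Y s ω e) (Y s ω e)) ∂P < ∞)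
    (i j : Fin 2) (t : ℝ≥0) :
    sqErr (fun s ω => (f (Y s ω) i j).re) 0 P t ≠ ⊤ ∧ sqErr (fun s ω => (f (Y s ω) i j).im) 0 P t ≠ ⊤ := by
  have hK : 0 ≤ max K 0 := le_max_right _ _
  have hgrow : ∀ Q : MatrixConfig 3 L 2, hsForm 2 (f Q) (f Q) ≤
      2 * hsForm 2 (f 0) (f 0) + 2 * max K 0 * ∑ e, hsForm 2 (Q e) (Q e) := by
    intro Q
    refine (hsForm_coeff_linearGrowth hf Q).trans ?_
    gcongr
    · exact Finset.sum_nonneg fun _ _ => hsForm_self_nonneg _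
    · exact le_max_left _ _
  have hC₀ : 0 ≤ 2 * hsForm 2 (f 0) (f 0) := by positivity [hsForm_self_nonneg (f 0)]
  refine ⟨sqErr_ne_top_of_dominated hC₀ (by positivity) (fun Q => (sq_re_le_hsForm _ i j).trans (hgrow Q)) hY2 t,
    sqErr_ne_top_of_dominated hC₀ (by positivity) (fun Q => (sq_im_le_hsForm _ i j).trans (hgrow Q)) hY2 t⟩

/-- **The stochastic integrals of one Picard step exist.**  On any probability space with a flat Brownian
motion `W` (filtration `𝓕 = hW.natFiltration`): for a tame coefficient map `f` (e.g. `Q ↦ S.noise Q e n` of a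
tame link SDE) and a process `Y` which is entrywise progressive for `𝓕` and in `L²(sup)` on bounded intervals,
the Itô integrals `∫ Re f(Y)_{ij} dW^i₀` and `∫ Im f(Y)_{ij} dW^i₀` against any coordinate `i₀` exist w.r.t.
`𝓕`, and are square-integrable martingales (Revuz–Yor IX (2.1), proof, the martingale part of the map `S`).
[folklore] -/
theorem exists_isItoIntegral_coeff_entry [IsProbabilityMeasure P] (hW : IsFlatBrownian W P)
    {Y : ℝ≥0 → Ω → MatrixConfig 3 L 2} {f : MatrixConfig 3 L 2 → Matrix (Fin 2) (Fin 2) ℂ} {K : ℝ}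
    (hf : ∀ Q Q' : MatrixConfig 3 L 2,
      hsForm 2 (f Q - f Q') (f Q - f Q') ≤ K * ∑ e', hsForm 2 (Q e' - Q' e') (Q e' - Q' e'))
    (hre : ∀ e i j, IsStronglyProgressive hW.natFiltration (fun t ω => (Y t ω e i j).re))
    (him : ∀ e i j, IsStronglyProgressive hW.natFiltration (fun t ω => (Y t ω e i j).im))
    (hY2 : ∀ t : ℝ≥0, ∫⁻ ω, ⨆ s ∈ Set.Iic t, ENNReal.ofReal (∑ e, hsForm 2 (Y s ω e) (Y s ω e)) ∂P < ∞)
    (i₀ : Edge 3 L × NoiseIdx 2) (i j : Fin 2) :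
    (∃ J : ℝ≥0 → Ω → ℝ, IsItoIntegral (fun t ω => (f (Y t ω) i j).re) (fun t ω => W t ω i₀) J hW.natFiltration P ∧
        Martingale J hW.natFiltration P ∧ ∀ t, MemLp (J t) 2 P) ∧
      ∃ J : ℝ≥0 → Ω → ℝ, IsItoIntegral (fun t ω => (f (Y t ω) i j).im) (fun t ω => W t ω i₀) J hW.natFiltration P ∧
        Martingale J hW.natFiltration P ∧ ∀ t, MemLp (J t) 2 P := by
  have hcont : Continuous f := continuous_of_hsForm_lipschitz hf
  refine ⟨exists_isItoIntegral_flatCoord hW i₀ (isStronglyProgressive_coeff_re hcont hre him i j)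
      fun t => (sqErr_coeff_entry_ne_top hf hY2 i j t).1,
    exists_isItoIntegral_flatCoord hW i₀ (isStronglyProgressive_coeff_im hcont hre him i j)
      fun t => (sqErr_coeff_entry_ne_top hf hY2 i j t).2⟩

end Integrals

end Summit.QuantumFields.YangMills.Theorems.ColdStartUniversality

end
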